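import Summits.ResolutionOfSingularities.ResolutionOfSingularities.Theorems.TropicalLinksInductiveStepLaurentRegularPi
import Summits.ResolutionOfSingularities.ResolutionOfSingularities.Theorems.SchonResolves.Negative.AntecedentNeedsReembedding

/-!
# `SchonResolves` (crux stmt-ResolutionOfSingularities-17234, route `TropicalLinks`), negative-side support:
# the re-embedding choice is load-bearing AT A SINGLE INSTANCE of the antecedent
# (refuter cdisprove seat, gen 2; this file does NOT refute the crux)

Companion of `Negative/AntecedentNeedsReembedding.lean` (a guard-passing re-embedding
`(m, G) = (1, (x₁−1)²)` of `U = 𝔾_m`, `N = 1`, `I = ⊥`, VIOLATES the schön clause of the antecedent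
`SchonAt p 1`) and `Negative/AntecedentForallFalse.lean` (hence the `∀ (m, G)`-strengthening of
`SchonAt p 1` is false). Here the other half, kernel-checked, so that the load-bearing analysis of the
antecedent is complete at this instance:

* `trivial_extIdeal_eq_bot` — with NO new units (`m = 0`, the empty family `G = Fin.elim0`) the route's
  extended ideal of `I = ⊥ ⊆ k[ℤ¹]` is `⊥ ⊆ k[ℤ^(1+0)]` (`ι(⊥) = 0`, no generators `y_j − ι G_j`);
* `schonClause_holds_for_trivial_reembedding` — the schön clause (the route's text verbatim, under
  `open scoped Classical`) HOLDS for `(k, N, I, m, G) = (k, 1, ⊥, 0, ∅)`: every initial ideal of `⊥` is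
  `⊥` and the torus `k[ℤ¹]` is regular at every prime (the landed brick
  `tropicalLinks_isSchonIdeal_bot`, through the bridge `tropicalLinks_weightInitialIdeal_eq_span`);
* `exists_guarded_reembedding_schonClause`, `schonAt_one_body_holds_at_torus` — so the antecedent's
  `∃ (m, G), (∀ j, G j ∉ I) ∧ clause` is TRUE at `(k, 1, ⊥)` for every field `k` (in particular the
  witness of the companion files does not make the antecedent junk-false, which by the crux's shape
  `H → C` would have made the crux trivially true at that prime);
* `guarded_reembedding_choice_loadBearing` — **at one and the same instance `(k, 1, ⊥)` of the
  antecedent there is a guarded re-embedding satisfying the schön clause AND one violating it.**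
  READING FOR PROVERS: whatever a proof of `SchonResolves` extracts from the antecedent must depend on
  the particular `G` it delivers (the torus `𝔾_m^(N+m)`, `Trop U[G⁻¹]` and the initial degenerations
  are functions of `G`, not of the variety `U[G⁻¹]` alone — here both re-embeddings have regular
  `U[G⁻¹]`).

No definitions; nothing positive about a Theses declaration is concluded (the positive statement is
one instance of the BODY of the antecedent, i.e. of a hypothesis of the crux).
-/

noncomputable section

-- single-problem summit: the doubled namespace component `ResolutionOfSingularities` is forced
set_option linter.dupNamespace false

namespace Summit.ResolutionOfSingularities.ResolutionOfSingularities.Theorems.SchonResolves.Negative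

open AddMonoidAlgebra
open Literature.AlgebraicGeometry.Tropical

section TrivialReembedding

open scoped Classical

variable (k : Type) [Field k]

/-- **The route's extended ideal at `(N, I, m, G) = (1, ⊥, 0, ∅)` is `⊥`**: `ι(⊥) = {0}` and there
are no new generators. [folklore] -/
theorem trivial_extIdeal_eq_bot :
    Ideal.span ((fun f : AddMonoidAlgebra k (Fin 1 → ℤ) => (AddMonoidAlgebra.ofCoeff (f.coeff.mapDomain fun v => Fin.append v (0 : Fin 0 → ℤ)) : AddMonoidAlgebra k (Fin (1 + 0) → ℤ))) '' (↑(⊥ : Ideal (AddMonoidAlgebra k (Fin 1 → ℤ))) : Set (AddMonoidAlgebra k (Fin 1 → ℤ))) ∪ Set.range (fun j : Fin 0 => AddMonoidAlgebra.single (Fin.append (0 : Fin 1 → ℤ) (Pi.single j (1 : ℤ))) (1 : k) - AddMonoidAlgebra.ofCoeff (((Fin.elim0 : Fin 0 → AddMonoidAlgebra k (Fin 1 → ℤ)) j).coeff.mapDomain fun v => Fin.append v (0 : Fin 0 → ℤ)))) = ⊥ := by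
  rw [Set.range_eq_empty, Set.union_empty, Submodule.bot_coe, Set.image_singleton, coeff_zero,
    Finsupp.mapDomain_zero, ofCoeff_zero]
  exact Ideal.span_singleton_eq_bot.mpr rfl

/-- **The schön clause HOLDS for the trivial re-embedding of the torus** `U = 𝔾_m ⊆ 𝔾_m¹`
(`N = 1`, `I = ⊥`, `m = 0`): for every weight `w` the inlined initial ideal of the extended ideal `⊥`
is `in_w(⊥) = ⊥`, and `k[ℤ^(1+0)]` is regular at every prime (`tropicalLinks_isSchonIdeal_bot`).
Displayed: the route's clause text at these parameters. [folklore] -/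
theorem schonClause_holds_for_trivial_reembedding :
    ∀ (w : Fin (1 + 0) → ℤ) (P : Ideal (AddMonoidAlgebra k (Fin (1 + 0) → ℤ) ⧸ Ideal.span ((fun f : AddMonoidAlgebra k (Fin (1 + 0) → ℤ) => AddMonoidAlgebra.ofCoeff (f.coeff.filter fun v => ∀ u ∈ f.coeff.support, ∑ i, w i * v i ≤ ∑ i, w i * u i)) '' (↑(Ideal.span ((fun f : AddMonoidAlgebra k (Fin 1 → ℤ) => (AddMonoidAlgebra.ofCoeff (f.coeff.mapDomain fun v => Fin.append v (0 : Fin 0 → ℤ)) : AddMonoidAlgebra k (Fin (1 + 0) → ℤ))) '' (↑(⊥ : Ideal (AddMonoidAlgebra k (Fin 1 → ℤ))) : Set (AddMonoidAlgebra k (Fin 1 → ℤ))) ∪ Set.range (fun j : Fin 0 => AddMonoidAlgebra.single (Fin.append (0 : Fin 1 → ℤ) (Pi.single j (1 : ℤ))) (1 : k) - AddMonoidAlgebra.ofCoeff (((Fin.elim0 : Fin 0 → AddMonoidAlgebra k (Fin 1 → ℤ)) j).coeff.mapDomain fun v => Fin.append v (0 : Fin 0 → ℤ))))) : Set (AddMonoidAlgebra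 k (Fin (1 + 0) → ℤ)))))) [P.IsPrime], IsRegularLocalRing (Localization.AtPrime P) := by
  intro w
  rw [trivial_extIdeal_eq_bot k]
  exact (Summit.ResolutionOfSingularities.ResolutionOfSingularities.Theorems.tropicalLinks_forall_prime_regular_congr
    (Summit.ResolutionOfSingularities.ResolutionOfSingularities.Theorems.tropicalLinks_weightInitialIdeal_eq_span w _ _)).mp
      (Summit.ResolutionOfSingularities.ResolutionOfSingularities.Theorems.tropicalLinks_isSchonIdeal_bot k (1 + 0) w)

/-- **The antecedent's `∃ (m, G)` is satisfiable at `(k, N, I) = (k, 1, ⊥)`** — by the EMPTY family of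
new units. Displayed: the route's `(∀ j, G j ∉ I) ∧`-clause at `N = 1`, `I = ⊥`. [folklore] -/
theorem exists_guarded_reembedding_schonClause :
    ∃ (m : ℕ) (G : Fin m → AddMonoidAlgebra k (Fin 1 → ℤ)), (∀ j, G j ∉ (⊥ : Ideal (AddMonoidAlgebra k (Fin 1 → ℤ)))) ∧
      (∀ (w : Fin (1 + m) → ℤ) (P : Ideal (AddMonoidAlgebra k (Fin (1 + m) → ℤ) ⧸ Ideal.span ((fun f : AddMonoidAlgebra k (Fin (1 + m) → ℤ) => AddMonoidAlgebra.ofCoeff (f.coeff.filter fun v => ∀ u ∈ f.coeff.support, ∑ i, w i * v i ≤ ∑ i, w i * u i)) '' (↑(Ideal.span ((fun f : AddMonoidAlgebra k (Fin 1 → ℤ) => (AddMonoidAlgebra.ofCoeff (f.coeff.mapDomain fun v => Fin.append v (0 : Fin m → ℤ)) : AddMonoidAlgebra k (Fin (1 + m) → ℤ))) '' (↑(⊥ : Ideal (AddMonoidAlgebra k (Fin 1 → ℤ))) : Set (AddMonoidAlgebra k (Fin 1 → ℤ))) ∪ Set.range (fun j : Fin m => AddMonoidAlgebra.single (Fin.append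 (0 : Fin 1 → ℤ) (Pi.single j (1 : ℤ))) (1 : k) - AddMonoidAlgebra.ofCoeff ((G j).coeff.mapDomain fun v => Fin.append v (0 : Fin m → ℤ))))) : Set (AddMonoidAlgebra k (Fin (1 + m) → ℤ)))))) [P.IsPrime], IsRegularLocalRing (Localization.AtPrime P)) :=
  ⟨0, Fin.elim0, fun j => j.elim0, schonClause_holds_for_trivial_reembedding k⟩

/-- **Load-bearing at one instance.** At the instance `(k, 1, ⊥)` of the antecedent `SchonAt p 1`
(any field `k`) there is a guard-passing re-embedding for which the schön clause HOLDS (`m = 0`) and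
one for which it FAILS (`(m, G) = (1, (x₁−1)²)`, `exists_guarded_reembedding_not_schonClause`): the
clause is a property of the chosen embedding, not of the regular curve `U[G⁻¹]`. [folklore] -/
theorem guarded_reembedding_choice_loadBearing :
    (∃ (m : ℕ) (G : Fin m → AddMonoidAlgebra k (Fin 1 → ℤ)), (∀ j, G j ∉ (⊥ : Ideal (AddMonoidAlgebra k (Fin 1 → ℤ)))) ∧
      (∀ (w : Fin (1 + m) → ℤ) (P : Ideal (AddMonoidAlgebra k (Fin (1 + m) → ℤ) ⧸ Ideal.span ((fun f : AddMonoidAlgebra k (Fin (1 + m) → ℤ) => AddMonoidAlgebra.ofCoeff (f.coeff.filter fun v => ∀ u ∈ f.coeff.support, ∑ i, w i * v i ≤ ∑ i, w i * u i)) '' (↑(Ideal.span ((fun f : AddMonoidAlgebra k (Fin 1 → ℤ) => (AddMonoidAlgebra.ofCoeff (f.coeff.mapDomain fun v => Fin.append v (0 : Fin m → ℤ)) : AddMonoidAlgebra k (Fin (1 + m) → ℤ))) '' (↑(⊥ : Ideal (AddMonoidAlgebra k (Fin 1 → ℤ))) : Set (AddMonoidAlgebra k (Fin 1 → ℤ)))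 ∪ Set.range (fun j : Fin m => AddMonoidAlgebra.single (Fin.append (0 : Fin 1 → ℤ) (Pi.single j (1 : ℤ))) (1 : k) - AddMonoidAlgebra.ofCoeff ((G j).coeff.mapDomain fun v => Fin.append v (0 : Fin m → ℤ))))) : Set (AddMonoidAlgebra k (Fin (1 + m) → ℤ)))))) [P.IsPrime], IsRegularLocalRing (Localization.AtPrime P))) ∧
    (∃ (m : ℕ) (G : Fin m → AddMonoidAlgebra k (Fin 1 → ℤ)), (∀ j, G j ∉ (⊥ : Ideal (AddMonoidAlgebra k (Fin 1 → ℤ)))) ∧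
      ¬ (∀ (w : Fin (1 + m) → ℤ) (P : Ideal (AddMonoidAlgebra k (Fin (1 + m) → ℤ) ⧸ Ideal.span ((fun f : AddMonoidAlgebra k (Fin (1 + m) → ℤ) => AddMonoidAlgebra.ofCoeff (f.coeff.filter fun v => ∀ u ∈ f.coeff.support, ∑ i, w i * v i ≤ ∑ i, w i * u i)) '' (↑(Ideal.span ((fun f : AddMonoidAlgebra k (Fin 1 → ℤ) => (AddMonoidAlgebra.ofCoeff (f.coeff.mapDomain fun v => Fin.append v (0 : Fin m → ℤ)) : AddMonoidAlgebra k (Fin (1 + m) → ℤ))) '' (↑(⊥ : Ideal (AddMonoidAlgebra k (Fin 1 → ℤ))) : Set (AddMonoidAlgebra k (Fin 1 → ℤ))) ∪ Set.range (fun j : Fin m => AddMonoidAlgebra.single (Fin.append (0 : Fin 1 → ℤ) (Pi.single j (1 : ℤ))) (1 : k) - AddMonoidAlgebra.ofCoeff ((G j).coeff.mapDomain fun v => Fin.append v (0 : Fin m → ℤ))))) : Set (AddMonoidAlgebra k (Fin (1 + m) → ℤ)))))) [P.IsPrime], IsRegularLocalRing (Localization.AtPrime P))) :=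
  ⟨exists_guarded_reembedding_schonClause k, exists_guarded_reembedding_not_schonClause k⟩

end TrivialReembedding

section ReadBack

open scoped Classical

/-- **Read-back against the antecedent**: the body of `SchonAt p 1` (prime `I`, `ringKrullDim = 1`,
then `∃ (m, G), …`, text verbatim at `N = 1`) holds at `I = ⊥ ⊆ k[ℤ¹]` for every field `k`, whatever
its characteristic — the two hypotheses are not even needed. [folklore] -/
theorem schonAt_one_body_holds_at_torus (k : Type) [Field k] (I : Ideal (AddMonoidAlgebra k (Fin 1 → ℤ))) (hI : I = ⊥) :
    I.IsPrime → ringKrullDim (AddMonoidAlgebra k (Fin 1 → ℤ) ⧸ I) = ((1 : ℕ) : WithBot ℕ∞) →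
      ∃ (m : ℕ) (G : Fin m → AddMonoidAlgebra k (Fin 1 → ℤ)), (∀ j, G j ∉ I) ∧
        (∀ (w : Fin (1 + m) → ℤ) (P : Ideal (AddMonoidAlgebra k (Fin (1 + m) → ℤ) ⧸ Ideal.span ((fun f : AddMonoidAlgebra k (Fin (1 + m) → ℤ) => AddMonoidAlgebra.ofCoeff (f.coeff.filter fun v => ∀ u ∈ f.coeff.support, ∑ i, w i * v i ≤ ∑ i, w i * u i)) '' (↑(Ideal.span ((fun f : AddMonoidAlgebra k (Fin 1 → ℤ) => (AddMonoidAlgebra.ofCoeff (f.coeff.mapDomain fun v => Fin.append v (0 : Fin m → ℤ)) : AddMonoidAlgebra k (Fin (1 + m) → ℤ))) '' (↑I : Set (AddMonoidAlgebra k (Fin 1 → ℤ))) ∪ Set.range (fun j : Fin m => AddMonoidAlgebra.single (Fin.append (0 : Fin 1 → ℤ) (Pi.single j (1 : ℤ))) (1 : k) - AddMonoidAlgebra.ofCoeff ((G j).coeff.mapDomain fun v => Fin.append v (0 : Fin m → ℤ))))) : Set (AddMonoidAlgebra k (Fin (1 + m) → ℤ)))))) [P.IsPrime], IsRegularLocalRing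 (Localization.AtPrime P)) := by
  subst hI
  exact fun _ _ => exists_guarded_reembedding_schonClause k

end ReadBack

end Summit.ResolutionOfSingularities.ResolutionOfSingularities.Theorems.SchonResolves.Negative

end
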